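import Mathlib
import Literature.MathematicalPhysics.QuantumFieldTheory.Balaban1983to89.B13

/-!
# `Balaban1983to89.B13Step237` — the component / family resummation (2.35) ⇒ (2.37) of B13 pp. 19–20 with honest
# α₆-bookkeeping: the step consumes `2(L+2)⁴O(1)ε₂ · exp 5(1−7δ)½Lκ ≤ α₆`, not the printed `2(L+2)⁴O(1)ε₂ exp 5κ ≤ 1`

CITATION HEADER (lean-in-tree rule 2026-08-18).  T. Bałaban, *Renormalization group approach to lattice gauge field
theories. II. Cluster expansions*, Commun. Math. Phys. **116**, 1–22 (1988), doi:10.1007/bf01239022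
[Balaban1988RG2Cluster] (cell paper B13; held `paper:balaban1988-cmp116-rg-ii-cluster`, journal page = PDF page).
The displays quoted below were compared with the renders `b2b-balaban-ref1/pages/1988-cmp116-rg-II-cluster/
1988-cmp116-rg-II-cluster-p018-x2.png`, `…-p019-x2.png`, `…-p020-x2.png` READ AS IMAGES (2026-08-19), not from the
OCR layer.  The paper is UNDER ADJUDICATION by the audit cell `pub-balaban`; nothing of it is asserted here: the two
combinatorial inputs of the step — the merging inequality (2.27) and the family-sum inequality (2.29), both AT SCALE
k + 1 — enter as explicit HYPOTHESES on abstract finite data (the (2.29)-hypothesis has literally the summand shape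
`∏ Y ∈ D, α₆ * Real.exp (-(r * d Y))` of `…Balaban1983to89.B13FamilySum.Ineq229` of unit pv18, which proves (2.29)
from (1.26); that module is referred to BY NAME and not imported), the constants record `B13.Consts` (fields
`L, δ, κ, ε₁, α₆, A₁`, the p. 19 product `Consts.eps2`, the p. 20 activity constant `Consts.C3act`, the closing
assumption `Consts.R22gen` and the theorems `Consts.C3act_mul_eps1`, `Consts.rates_of_R22gen`) of
`…Balaban1983to89.B13` (unit r2/b13) is used BY NAME, and everything below is proved by the kernel from Mathlib (finite
sums and products, monotonicity of `Real.exp`).  This module is a NEW LEAF: it imports `B13` and modifies nothing.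
Unit `b2b-balaban-b13-g24` (paper sub-cell B13, gen 24); cell records GAPS C-B13-51 (owner-side reading of the
adversarial rows C-adv7-159 / 160 / 162), C-B13-52 (this leaf), C-B13-35 UPDATE-5 (census CENSUS-B13-v2 v2.5),
DIVERGENCE D-b13.33 (the second α₆⁻¹ carried by the O(1) of C₃); it makes the located finding C-adv7-162 (d) of the
adversarial unit adv7 (gen 63) a tree fact and adds a kernel NECESSITY example.

WHAT IS PRINTED (verbatim; below `s` abbreviates the coarse rate unit ½Lκ — ℓκ in the cell's certified reading with a
general transfer factor ℓ, `B13.Consts.R22gen`).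
* p. 18, (2.27) and (2.29): *"Σ_{Y∈𝐃}(d_k(Y) + 5) ≧ d_k(Y₀) + 5. (2.27)"* … *"Σ_𝐃 Π_{Y∈𝐃} α₆ exp(−δκd_k(Y)) ≦ 1 (2.29)
  for κ sufficiently large and α₆ sufficiently small."*
* p. 19 l. −5 – p. 20 l. 10: *"Now, the sum over the components can be decomposed into a sum over one component, plus a
  sum over two components, and so on. A sum over n components is estimated by a product of n sums, each … over
  independently changing components. The last sum is estimated using (1.28), with κ replaced by δκ, and with an
  additional sum over (L+2)⁴ cubes □′ from π_k, the cubes touching a fixed LM-cube in Z′_i. This yields a bound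
  similar to (2.35), with ε₂ replaced by (L+2)⁴O(1)ε₂, and (1−5δ)κd_k(Z_i) in the exponentials replaced by
  (1−6δ)½Lκd_{k+1}(Z′_i). For n > 1 we leave only one exponential, estimating by 1 the remaining ones with the same
  domain Z′_i. The sum over n ≧ 1 is now bounded by 2(L+2)⁴O(1)ε₂, assuming that (L+2)⁴O(1)ε₂ ≦ ½. Finally, the sum
  over all families of different localization domains Z′_i from 𝐃_{k+1}, satisfying the condition ∪_i Z′_i = Z′₀, is
  estimated using (2.29). We have δ½Lκd_{k+1}(Z′_i) instead of δκd_k(Y), but the inequality (2.29) is valid for all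
  k. The inequality (2.27) is used for the remaining exponential factors. Assuming that 2(L+2)⁴O(1)ε₂ exp 5κ ≦ 1, we
  obtain for a fixed Z′₀,
  |Σ_{𝐃,P,Z₀}(2.14)| ≦ exp(−(κ₁−1)(LM)⁻⁴|Z∖Z′₀|)[Π_i 2(L+2)⁴O(1)ε₂ exp(−(1−7δ)½Lκd_{k+1}(Z′_i))] exp O(1)α₅|Z|, (2.37)
  where now Z′_i denote connected components of Z′₀."*
* p. 20 l. −9: *"We define the constant C₃ = 2(L+2)⁴O(1)2E₀C₁α₄⁻¹α₆⁻¹M^q exp C₂κ₁."* (`B13.Consts.C3act`, whose field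
  `A₁` is that O(1).)

WHAT THIS FILE CERTIFIES (zero `sorry`).  Abstract data per connected component C of Z′₀: an index type of coarse
domains with lengths `d i ≥ 0` (= d_{k+1}(Z′)), the length `dC` of C (= d_{k+1}(C)), a finite set `Fam` of families
(finite sets of domains: the families of DIFFERENT domains with union C), the per-member weight `F·exp(−u·d i)`
delivered by the n-resummation (F = 2(L+2)⁴O(1)ε₂, u = (1−6δ)s) split as `u = t + r`, t = δs lent to (2.29) and
r = (1−7δ)s merged by (2.27); hypotheses: (2.27) `dC + 5 ≤ Σ_{i∈D}(d i + 5)` for every `D ∈ Fam`, and (2.29) at weight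
α: `Σ_{D∈Fam} Π_{i∈D} α·exp(−t·d i) ≤ 1`.
* §1 `nsum_le_two_mul` (the n-sum: Σ_{1≤n≤N} xⁿ ≤ 2x for 0 ≤ x ≤ ½); `merge_price` ((2.27) at rate r: a family of m + 1
  members costs `exp 5r` per EXTRA member — with `r` the rate being merged, not κ: C-adv7-162 (c), cell GAPS G-B13-10);
  `familySum_rate_mono` ((2.29) is antitone in the rate: the content of *"(2.29) is valid for all k"* once (2.29) holds
  at the smallest rate — C-adv7-162 (a)(b); the tree's `B13FamilySum.ineq229` is scale-free in any case).
* §2 THE STEP.  `prod_member_le` (one family of m + 1 members: `Π_{i∈D} F·e^{−u·d i} ≤ [Π_{i∈D} α·e^{−t·d i}] ·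
  (F/α)·e^{−r·dC} · (F·e^{5r}/α)^m` — every member must LEND a factor α to the (2.29)-weight, so the bracket that
  survives is F/α and every extra member costs F·e^{5r}/α); `familyStep` (HONEST FORM = C-adv7-162 (d): under
  `F·exp 5r ≤ α` the family sum is `≤ (F/α)·exp(−r·dC)`); `familyStep_printedBracket` (keeping the printed bracket F:
  `≤ F·e^{−r·dC}·(N₁ + F·e^{5r}/α²)`, N₁ = the number of singleton families — in print N₁ ≤ 1, the only singleton
  family with union C being {C}) and `familyStep_printedBracket_two` (`≤ (1+θ)·F·e^{−r·dC}` under the STRONGER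
  `F·e^{5r} ≤ θ·α²` and N₁ ≤ 1); `printedBracket_needs_alpha` (NECESSITY, a kernel example on `Fin 3`: the catalogue
  {{C}, {A, B}} with all lengths 0 and α = ½ satisfies (2.27), (2.29) and N₁ = 1, yet its family sum F + F² EXCEEDS the
  printed bracket F·e^{−r·dC} = F for EVERY F > 0 and every r — so NO restriction on F alone, in particular not the
  printed *"2(L+2)⁴O(1)ε₂ exp 5κ ≦ 1"*, yields (2.37) with the bracket as printed: a power of α₆ must enter the
  restriction or the bracket); `familyStep_components` (independent components multiply: `Fintype.piFinset`,
  `Finset.prod_univ_sum`).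
* §3 BOOKKEEPING against `B13.Consts`.  `memberF c A = (L+2)⁴·A·ε₂` and `bracketF c A = 2·memberF c A` (A = the O(1)
  of p. 20 l. 3); the printed restrictions `R18half` (*"(L+2)⁴O(1)ε₂ ≦ ½"*) and `R18` (*"2(L+2)⁴O(1)ε₂ exp 5κ ≦ 1"*,
  cell census R18) and the consumed one `R18sharp c A ℓ : bracketF c A · exp 5(1−7δ)ℓκ ≤ α₆`; `bracketF_A1`
  (`bracketF c c.A₁ = C3act·ε₁`); `bracketF_rebased`, `R18sharp_iff_rebased` (reading the O(1) of C₃ as A₁ = A/α₆ — it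
  absorbs the lent α₆⁻¹, legitimately, α₆ being an absolute constant fixed by (2.29), cf. `B13FamilySum.ineq229_unit` —
  the surviving bracket (F/α₆)·e^{−(1−7δ)ℓκ·dC} is LITERALLY C₃ε₁·e^{−(1−7δ)ℓκ·dC} and the consumed restriction reads
  `C3act·ε₁·exp 5(1−7δ)ℓκ ≤ 1`); `five_rate_of_R22gen` (under the closing assumption (1−10δ)ℓ = 1 the merged rate is
  5(1−7δ)ℓκ = 5κ + 15δℓκ: the printed `exp 5κ` UNDERSTATES the merging cost by `exp 15δℓκ` — e^{8.25κ} at L = 13,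
  ℓ = L/2 — and the cell's earlier sharp form "(1−6δ)" (G-B13-10) over-books it by `exp 5δℓκ`); `R18_of_R18sharp`
  (the consumed restriction implies the printed one, which is thus necessary, not sufficient, as displayed);
  `familyStep_consts`, `familyStep_consts_rebased` (§2 instantiated at F = bracketF c A, α = α₆, t = δℓκ,
  r = (1−7δ)ℓκ, u = (1−6δ)ℓκ).

HONEST SCOPE.  (i) Nothing geometric is proved here: which families occur, (2.27) and (2.29) at scale k + 1, the count
(L+2)⁴ and the transfer (2.36) behind the member rate (1−6δ)s are INPUTS typed as hypotheses on abstract finite data;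
the tree discharges (2.27) / (2.29) / (2.30) / (2.36) elsewhere (`B13FamilySum`, `TreeLength*`, `B13Geometry236*`).
(ii) The finding is a LOCATED SLIP ABSORBED BY THE CONVENTIONS, not an error in Lemma 3: ε₁ is chosen after α₆ in the
admissible order of choices (cell census §3), so `R18sharp` is satisfiable and (2.38) / (I.1.18) are unaffected; the
cell census row "pp. 19–20 merging at scale k+1" keeps class P with TWO located slips — rate: e^{5κ} → e^{5(1−7δ)ℓκ}
((1−7δ) is the rate left after δ is lent to (2.29)); constant: `≤ 1` → `≤ α₆`, equivalently the O(1) of C₃ carries a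
second α₆⁻¹ (DIVERGENCE D-b13.33).  (iii) `familyStep` is the adversarial unit's form (restriction F·e^{5r} ≤ α₆,
bracket F/α₆); `familyStep_printedBracket_two` is the alternative keeping the printed bracket up to a factor 1 + θ under
F·e^{5r} ≤ θα₆²; print fixes neither, and `printedBracket_needs_alpha` shows that one of the two prices must be paid.
(iv) ℓ, δ, κ are real parameters throughout; no numerical value of print is used.
-/

noncomputable section

namespace Literature.MathematicalPhysics.QuantumFieldTheory.Balaban1983to89.B13Step237

open Finset

/-! ## §1  Elementary pieces of p. 20 ll. 1–10 -/

/-- The n-resummation of p. 20 l. 5 (*"The sum over n ≧ 1 is now bounded by 2(L+2)⁴O(1)ε₂, assuming that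
(L+2)⁴O(1)ε₂ ≦ ½"*): for `0 ≤ x ≤ ½` every partial sum `Σ_{n<N} x^{n+1} ≤ 2x`. [cite: Balaban1988RG2Cluster, p.20 (before (2.37))] -/
theorem nsum_le_two_mul {x : ℝ} (hx0 : 0 ≤ x) (hx : x ≤ 1 / 2) (N : ℕ) :
    ∑ n ∈ Finset.range N, x ^ (n + 1) ≤ 2 * x := by
  have key : ∀ K : ℕ, ∑ n ∈ Finset.range K, x ^ (n + 1) ≤ 2 * x - 2 * x ^ (K + 1) := by
    intro K
    induction K with
    | zero => simp
    | succ K ih =>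
      rw [Finset.sum_range_succ]
      have hxK : 0 ≤ x ^ (K + 1) := pow_nonneg hx0 _
      have hpow : x ^ (K + 1 + 1) = x ^ (K + 1) * x := pow_succ x (K + 1)
      nlinarith [mul_le_mul_of_nonneg_left hx hxK]
  have hxN : 0 ≤ x ^ (N + 1) := pow_nonneg hx0 _
  linarith [key N]

/-- The merging price of (2.27) at a rate `r ≥ 0` (C-adv7-162 (c); cell GAPS G-B13-10): if a family `D` of `m + 1`
domains satisfies (2.27), `dC + 5 ≤ Σ_{i∈D}(d i + 5)`, then `Π_{i∈D} exp(−r·d i) ≤ exp(−r·dC)·(exp 5r)^m` — each EXTRA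
member costs `exp 5r` with `r` the rate being merged (at scale k + 1: r = (1−7δ)½Lκ), not `exp 5κ`. [cite: Balaban1988RG2Cluster, (2.27) p.18 and p.20 (before (2.37))] -/
theorem merge_price {ι : Type*} (D : Finset ι) (d : ι → ℝ) {dC r : ℝ} {m : ℕ} (hr : 0 ≤ r)
    (hm : D.card = m + 1) (h227 : dC + 5 ≤ ∑ i ∈ D, (d i + 5)) :
    ∏ i ∈ D, Real.exp (-(r * d i)) ≤ Real.exp (-(r * dC)) * Real.exp (5 * r) ^ m := by
  rw [← Real.exp_sum, ← Real.exp_nat_mul, ← Real.exp_add, Real.exp_le_exp]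
  have hsum : ∑ i ∈ D, (d i + 5) = ∑ i ∈ D, d i + 5 * ((m : ℝ) + 1) := by
    rw [Finset.sum_add_distrib, Finset.sum_const, hm, nsmul_eq_mul]
    push_cast
    ring
  have hneg : ∑ i ∈ D, -(r * d i) = -(r * ∑ i ∈ D, d i) := by
    rw [Finset.mul_sum, ← Finset.sum_neg_distrib]
  rw [hneg]
  rw [hsum] at h227
  have h1 : r * (dC - 5 * (m : ℝ)) ≤ r * ∑ i ∈ D, d i := mul_le_mul_of_nonneg_left (by linarith) hr
  nlinarith

/-- *"(2.29) is valid for all k"* (p. 20 l. 7; C-adv7-162 (a)(b)): the family sum of (2.29) is antitone in the rate, so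
(2.29) at the scale-k rate gives it at every larger rate (the lengths being ≥ 0); the tree's `B13FamilySum.ineq229`
(unit pv18) is stated for an arbitrary rate above its threshold in any case. [cite: Balaban1988RG2Cluster, (2.29) p.18 and p.20 (before (2.37))] -/
theorem familySum_rate_mono {ι : Type*} (Fam : Finset (Finset ι)) (d : ι → ℝ) {α t t' : ℝ} (hα : 0 ≤ α)
    (hd : ∀ i, 0 ≤ d i) (htt : t ≤ t') :
    ∑ D ∈ Fam, ∏ i ∈ D, (α * Real.exp (-(t' * d i))) ≤ ∑ D ∈ Fam, ∏ i ∈ D, (α * Real.exp (-(t * d i))) := by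
  apply Finset.sum_le_sum
  intro D _
  apply Finset.prod_le_prod (fun i _ => by positivity)
  intro i _
  apply mul_le_mul_of_nonneg_left _ hα
  apply Real.exp_le_exp.mpr
  nlinarith [hd i, mul_le_mul_of_nonneg_right htt (hd i)]

/-! ## §2  The family / merging step per connected component of Z′₀ -/

section Step

variable {ι : Type*}

/-- ONE FAMILY.  If `D` has `m + 1` members and satisfies (2.27) then, splitting the member rate `u = t + r`,
`Π_{i∈D} F·exp(−u·d i) ≤ [Π_{i∈D} α·exp(−t·d i)] · ((F/α)·exp(−r·dC)·(F·exp 5r/α)^m)`: every member LENDS a factor α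
to the (2.29)-weight, the bracket that survives is F/α, and every extra member costs `F·exp 5r/α`. [cite: Balaban1988RG2Cluster, p.20 ((2.35) ⇒ (2.37))] -/
theorem prod_member_le (D : Finset ι) (d : ι → ℝ) {dC F α t r u : ℝ} {m : ℕ} (hF : 0 ≤ F) (hα : 0 < α)
    (hr : 0 ≤ r) (hu : u = t + r) (hm : D.card = m + 1) (h227 : dC + 5 ≤ ∑ i ∈ D, (d i + 5)) :
    ∏ i ∈ D, (F * Real.exp (-(u * d i))) ≤
      (∏ i ∈ D, (α * Real.exp (-(t * d i)))) *
        (F / α * Real.exp (-(r * dC)) * (F * Real.exp (5 * r) / α) ^ m) := by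
  have hα0 : α ≠ 0 := hα.ne'
  have hfac : ∀ i ∈ D, F * Real.exp (-(u * d i)) =
      (α * Real.exp (-(t * d i))) * (F / α * Real.exp (-(r * d i))) := by
    intro i _
    have he : Real.exp (-(u * d i)) = Real.exp (-(t * d i)) * Real.exp (-(r * d i)) := by
      rw [← Real.exp_add]
      congr 1
      rw [hu]
      ring
    rw [he]
    field_simp
  rw [Finset.prod_congr rfl hfac, Finset.prod_mul_distrib]
  apply mul_le_mul_of_nonneg_left _ (Finset.prod_nonneg fun i _ => by positivity)
  rw [Finset.prod_mul_distrib, Finset.prod_const, hm]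
  calc (F / α) ^ (m + 1) * ∏ i ∈ D, Real.exp (-(r * d i))
      ≤ (F / α) ^ (m + 1) * (Real.exp (-(r * dC)) * Real.exp (5 * r) ^ m) :=
        mul_le_mul_of_nonneg_left (merge_price D d hr hm h227) (by positivity)
    _ = F / α * Real.exp (-(r * dC)) * (F * Real.exp (5 * r) / α) ^ m := by ring

/-- THE STEP, HONEST FORM (C-adv7-162 (d)).  Per connected component of Z′₀: if every family satisfies (2.27), the
(2.29)-sum at weight `α·exp(−t·d)` is ≤ 1 and `F·exp 5r ≤ α`, then
`Σ_{D∈Fam} Π_{i∈D} F·exp(−(t+r)·d i) ≤ (F/α)·exp(−r·dC)`: the restriction carries α (= α₆) on its right-hand side and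
the surviving bracket is F/α, not the printed F (at scale k + 1: F = 2(L+2)⁴O(1)ε₂, α = α₆, t = δ½Lκ,
r = (1−7δ)½Lκ). [cite: Balaban1988RG2Cluster, (2.37) p.20] -/
theorem familyStep (Fam : Finset (Finset ι)) (d : ι → ℝ) {dC F α t r u : ℝ} (hF : 0 ≤ F) (hα : 0 < α)
    (hr : 0 ≤ r) (hu : u = t + r) (h227 : ∀ D ∈ Fam, D.Nonempty ∧ dC + 5 ≤ ∑ i ∈ D, (d i + 5))
    (h229 : ∑ D ∈ Fam, ∏ i ∈ D, (α * Real.exp (-(t * d i))) ≤ 1) (hsmall : F * Real.exp (5 * r) ≤ α) :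
    ∑ D ∈ Fam, ∏ i ∈ D, (F * Real.exp (-(u * d i))) ≤ F / α * Real.exp (-(r * dC)) := by
  have hx0 : 0 ≤ F * Real.exp (5 * r) / α := by positivity
  have hx1 : F * Real.exp (5 * r) / α ≤ 1 := by rwa [div_le_one hα]
  have hB : 0 ≤ F / α * Real.exp (-(r * dC)) := by positivity
  have hper : ∀ D ∈ Fam, ∏ i ∈ D, (F * Real.exp (-(u * d i))) ≤
      (∏ i ∈ D, (α * Real.exp (-(t * d i)))) * (F / α * Real.exp (-(r * dC))) := by
    intro D hD
    obtain ⟨hne, h27⟩ := h227 D hD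
    obtain ⟨m, hm⟩ : ∃ m, D.card = m + 1 := ⟨D.card - 1, by have := hne.card_pos; omega⟩
    have hP : 0 ≤ ∏ i ∈ D, (α * Real.exp (-(t * d i))) := Finset.prod_nonneg fun i _ => by positivity
    calc ∏ i ∈ D, (F * Real.exp (-(u * d i)))
        ≤ (∏ i ∈ D, (α * Real.exp (-(t * d i)))) *
            (F / α * Real.exp (-(r * dC)) * (F * Real.exp (5 * r) / α) ^ m) :=
          prod_member_le D d hF hα hr hu hm h27
      _ ≤ (∏ i ∈ D, (α * Real.exp (-(t * d i)))) * (F / α * Real.exp (-(r * dC)) * 1) := by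
          apply mul_le_mul_of_nonneg_left _ hP
          exact mul_le_mul_of_nonneg_left (pow_le_one₀ hx0 hx1) hB
      _ = _ := by rw [mul_one]
  calc ∑ D ∈ Fam, ∏ i ∈ D, (F * Real.exp (-(u * d i)))
      ≤ ∑ D ∈ Fam, (∏ i ∈ D, (α * Real.exp (-(t * d i)))) * (F / α * Real.exp (-(r * dC))) :=
        Finset.sum_le_sum hper
    _ = (∑ D ∈ Fam, ∏ i ∈ D, (α * Real.exp (-(t * d i)))) * (F / α * Real.exp (-(r * dC))) := by
        rw [Finset.sum_mul]
    _ ≤ 1 * (F / α * Real.exp (-(r * dC))) := mul_le_mul_of_nonneg_right h229 hB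
    _ = F / α * Real.exp (-(r * dC)) := one_mul _

/-- THE STEP WITH THE PRINTED BRACKET KEPT.  Under the same hypotheses plus `t ≥ 0`, lengths `≥ 0`:
`Σ_{D∈Fam} Π_{i∈D} F·exp(−(t+r)·d i) ≤ F·exp(−r·dC)·(N₁ + F·exp 5r/α²)`, where N₁ is the number of SINGLETON families in
`Fam` (in print N₁ ≤ 1: the only one-member family of different domains with union C is {C}); the multi-member
families contribute the relative amount F·e^{5r}/α², small only under a restriction quadratic in α. [cite: Balaban1988RG2Cluster, (2.37) p.20] -/
theorem familyStep_printedBracket (Fam : Finset (Finset ι)) (d : ι → ℝ) {dC F α t r u : ℝ} (hF : 0 ≤ F)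
    (hα : 0 < α) (ht : 0 ≤ t) (hr : 0 ≤ r) (hu : u = t + r) (hd : ∀ i, 0 ≤ d i)
    (h227 : ∀ D ∈ Fam, D.Nonempty ∧ dC + 5 ≤ ∑ i ∈ D, (d i + 5))
    (h229 : ∑ D ∈ Fam, ∏ i ∈ D, (α * Real.exp (-(t * d i))) ≤ 1) (hsmall : F * Real.exp (5 * r) ≤ α) :
    ∑ D ∈ Fam, ∏ i ∈ D, (F * Real.exp (-(u * d i))) ≤
      F * Real.exp (-(r * dC)) *
        (((Fam.filter fun D => D.card = 1).card : ℝ) + F * Real.exp (5 * r) / α ^ 2) := by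
  classical
  have hα0 : α ≠ 0 := hα.ne'
  rw [← Finset.sum_filter_add_sum_filter_not Fam (fun D => D.card = 1)]
  -- the singleton families
  have h1 : ∑ D ∈ Fam.filter (fun D => D.card = 1), ∏ i ∈ D, (F * Real.exp (-(u * d i))) ≤
      ((Fam.filter fun D => D.card = 1).card : ℝ) * (F * Real.exp (-(r * dC))) := by
    have hle : ∀ D ∈ Fam.filter (fun D => D.card = 1),
        ∏ i ∈ D, (F * Real.exp (-(u * d i))) ≤ F * Real.exp (-(r * dC)) := by
      intro D hD
      rw [Finset.mem_filter] at hD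
      obtain ⟨i, rfl⟩ := Finset.card_eq_one.mp hD.2
      have h27 := (h227 _ hD.1).2
      rw [Finset.sum_singleton] at h27
      rw [Finset.prod_singleton]
      apply mul_le_mul_of_nonneg_left _ hF
      apply Real.exp_le_exp.mpr
      rw [hu]
      nlinarith [hd i, mul_nonneg ht (hd i), mul_le_mul_of_nonneg_left (show dC ≤ d i by linarith) hr]
    calc ∑ D ∈ Fam.filter (fun D => D.card = 1), ∏ i ∈ D, (F * Real.exp (-(u * d i)))
        ≤ ∑ D ∈ Fam.filter (fun D => D.card = 1), F * Real.exp (-(r * dC)) := Finset.sum_le_sum hle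
      _ = _ := by rw [Finset.sum_const, nsmul_eq_mul]
  -- the families with at least two members
  have hB : 0 ≤ F * Real.exp (-(r * dC)) * (F * Real.exp (5 * r) / α ^ 2) := by positivity
  have h2 : ∑ D ∈ Fam.filter (fun D => ¬D.card = 1), ∏ i ∈ D, (F * Real.exp (-(u * d i))) ≤
      (∑ D ∈ Fam.filter (fun D => ¬D.card = 1), ∏ i ∈ D, (α * Real.exp (-(t * d i)))) *
        (F * Real.exp (-(r * dC)) * (F * Real.exp (5 * r) / α ^ 2)) := by
    rw [Finset.sum_mul]
    apply Finset.sum_le_sum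
    intro D hD
    rw [Finset.mem_filter] at hD
    obtain ⟨hne, h27⟩ := h227 D hD.1
    have hpos := hne.card_pos
    obtain ⟨m, hm⟩ : ∃ m, D.card = m + 1 := ⟨D.card - 1, by omega⟩
    have hm1 : m ≠ 0 := by have := hD.2; omega
    have hx0 : 0 ≤ F * Real.exp (5 * r) / α := by positivity
    have hx1 : F * Real.exp (5 * r) / α ≤ 1 := by rwa [div_le_one hα]
    have hpow : (F * Real.exp (5 * r) / α) ^ m ≤ F * Real.exp (5 * r) / α := pow_le_of_le_one hx0 hx1 hm1
    have hP : 0 ≤ ∏ i ∈ D, (α * Real.exp (-(t * d i))) := Finset.prod_nonneg fun i _ => by positivity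
    have hB' : 0 ≤ F / α * Real.exp (-(r * dC)) := by positivity
    calc ∏ i ∈ D, (F * Real.exp (-(u * d i)))
        ≤ (∏ i ∈ D, (α * Real.exp (-(t * d i)))) *
            (F / α * Real.exp (-(r * dC)) * (F * Real.exp (5 * r) / α) ^ m) :=
          prod_member_le D d hF hα hr hu hm h27
      _ ≤ (∏ i ∈ D, (α * Real.exp (-(t * d i)))) *
            (F / α * Real.exp (-(r * dC)) * (F * Real.exp (5 * r) / α)) :=
          mul_le_mul_of_nonneg_left (mul_le_mul_of_nonneg_left hpow hB') hP
      _ = (∏ i ∈ D, (α * Real.exp (-(t * d i)))) *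
            (F * Real.exp (-(r * dC)) * (F * Real.exp (5 * r) / α ^ 2)) := by
          congr 1
          field_simp
  have hMle : ∑ D ∈ Fam.filter (fun D => ¬D.card = 1), ∏ i ∈ D, (α * Real.exp (-(t * d i))) ≤ 1 :=
    le_trans (Finset.sum_le_sum_of_subset_of_nonneg (Finset.filter_subset _ _)
      (fun D _ _ => Finset.prod_nonneg fun i _ => by positivity)) h229
  calc ∑ D ∈ Fam.filter (fun D => D.card = 1), ∏ i ∈ D, (F * Real.exp (-(u * d i))) +
        ∑ D ∈ Fam.filter (fun D => ¬D.card = 1), ∏ i ∈ D, (F * Real.exp (-(u * d i)))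
      ≤ ((Fam.filter fun D => D.card = 1).card : ℝ) * (F * Real.exp (-(r * dC))) +
          1 * (F * Real.exp (-(r * dC)) * (F * Real.exp (5 * r) / α ^ 2)) :=
        add_le_add h1 (le_trans h2 (mul_le_mul_of_nonneg_right hMle hB))
    _ = _ := by ring

/-- The printed-bracket form made quantitative: if at most one family is a singleton (print: {C}), `α ≤ 1`, and the
STRONGER restriction `F·exp 5r ≤ θ·α²` with `θ ≤ 1` holds, the family sum is `≤ (1 + θ)·F·exp(−r·dC)` — the printed
bracket of (2.37) up to the factor 1 + θ. [cite: Balaban1988RG2Cluster, (2.37) p.20] -/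
theorem familyStep_printedBracket_two (Fam : Finset (Finset ι)) (d : ι → ℝ) {dC F α t r u θ : ℝ} (hF : 0 ≤ F)
    (hα : 0 < α) (hα1 : α ≤ 1) (ht : 0 ≤ t) (hr : 0 ≤ r) (hu : u = t + r) (hd : ∀ i, 0 ≤ d i)
    (hθ1 : θ ≤ 1)
    (h227 : ∀ D ∈ Fam, D.Nonempty ∧ dC + 5 ≤ ∑ i ∈ D, (d i + 5))
    (h229 : ∑ D ∈ Fam, ∏ i ∈ D, (α * Real.exp (-(t * d i))) ≤ 1)
    (hN1 : (Fam.filter fun D => D.card = 1).card ≤ 1) (hsmall2 : F * Real.exp (5 * r) ≤ θ * α ^ 2) :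
    ∑ D ∈ Fam, ∏ i ∈ D, (F * Real.exp (-(u * d i))) ≤ (1 + θ) * (F * Real.exp (-(r * dC))) := by
  have hα2 : θ * α ^ 2 ≤ α := by nlinarith [mul_le_mul hθ1 hα1 hα.le zero_le_one]
  have hsmall : F * Real.exp (5 * r) ≤ α := le_trans hsmall2 hα2
  have hq : F * Real.exp (5 * r) / α ^ 2 ≤ θ := by
    rw [div_le_iff₀ (by positivity)]
    exact hsmall2
  have hN : ((Fam.filter fun D => D.card = 1).card : ℝ) ≤ 1 := by exact_mod_cast hN1
  have hB : 0 ≤ F * Real.exp (-(r * dC)) := by positivity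
  calc ∑ D ∈ Fam, ∏ i ∈ D, (F * Real.exp (-(u * d i)))
      ≤ F * Real.exp (-(r * dC)) *
          (((Fam.filter fun D => D.card = 1).card : ℝ) + F * Real.exp (5 * r) / α ^ 2) :=
        familyStep_printedBracket Fam d hF hα ht hr hu hd h227 h229 hsmall
    _ ≤ F * Real.exp (-(r * dC)) * (1 + θ) := mul_le_mul_of_nonneg_left (add_le_add hN hq) hB
    _ = (1 + θ) * (F * Real.exp (-(r * dC))) := by ring

end Step

/-- NECESSITY of an α-dependence (kernel example).  On `Fin 3` (domains C = 0, A = 1, B = 2) take the catalogue of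
families `{{C}, {A, B}}`, all lengths 0, `dC = 0`, α = ½, t = 0: (2.27) holds for both families, the (2.29)-sum is
½ + ¼ ≤ 1, exactly one family is a singleton, and yet for EVERY F > 0 and every rate r the family sum `F + F²` is
STRICTLY LARGER than the printed bracket `F·exp(−r·dC) = F` of (2.37): no restriction on F = 2(L+2)⁴O(1)ε₂ alone (in
particular not the printed *"2(L+2)⁴O(1)ε₂ exp 5κ ≦ 1"*) can yield (2.37) with the bracket as printed from (2.27) and
(2.29) — a power of α₆ has to enter (`familyStep`: restriction `≤ α₆`, bracket F/α₆; `familyStep_printedBracket_two`: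
restriction `≤ θα₆²`, bracket (1+θ)F). [cite: Balaban1988RG2Cluster, (2.37) p.20] -/
theorem printedBracket_needs_alpha :
    ∃ (Fam : Finset (Finset (Fin 3))) (d : Fin 3 → ℝ) (dC α t : ℝ),
      (∀ i, 0 ≤ d i) ∧ 0 ≤ dC ∧ 0 < α ∧ α ≤ 1 ∧ 0 ≤ t ∧
      (∀ D ∈ Fam, D.Nonempty ∧ dC + 5 ≤ ∑ i ∈ D, (d i + 5)) ∧
      (∑ D ∈ Fam, ∏ i ∈ D, (α * Real.exp (-(t * d i))) ≤ 1) ∧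
      (Fam.filter fun D => D.card = 1).card = 1 ∧
      ∀ F r : ℝ, 0 < F →
        F * Real.exp (-(r * dC)) < ∑ D ∈ Fam, ∏ i ∈ D, (F * Real.exp (-((t + r) * d i))) := by
  have hne : ({0} : Finset (Fin 3)) ≠ {1, 2} := by decide
  refine ⟨{{0}, {1, 2}}, fun _ => 0, 0, 1 / 2, 0, fun _ => le_rfl, le_rfl, by norm_num, by norm_num, le_rfl,
    ?_, ?_, ?_, ?_⟩
  · intro D hD
    simp only [Finset.mem_insert, Finset.mem_singleton] at hD
    rcases hD with rfl | rfl
    · exact ⟨⟨0, by simp⟩, by simp⟩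
    · exact ⟨⟨1, by simp⟩, by simp⟩
  · rw [Finset.sum_pair hne]
    simp
    norm_num
  · decide
  · intro F r hF
    rw [Finset.sum_pair hne]
    simp
    nlinarith

/-- INDEPENDENT COMPONENTS MULTIPLY (p. 19 l. −4: *"a product of n sums, each … over independently changing
components"*, here for the components Z′_i of Z′₀ in (2.37)): choosing one family per component and summing the product
of the member weights over all choices gives at most the product of the per-component brackets `(F/α)·exp(−r·dC j)`. [cite: Balaban1988RG2Cluster, (2.37) p.20] -/
theorem familyStep_components {J : Type*} [Fintype J] [DecidableEq J] {ι : J → Type*}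
    [∀ j, DecidableEq (ι j)] (Fam : ∀ j, Finset (Finset (ι j))) (d : ∀ j, ι j → ℝ) (dC : J → ℝ)
    {F α t r u : ℝ} (hF : 0 ≤ F) (hα : 0 < α) (hr : 0 ≤ r) (hu : u = t + r)
    (h227 : ∀ j, ∀ D ∈ Fam j, D.Nonempty ∧ dC j + 5 ≤ ∑ i ∈ D, (d j i + 5))
    (h229 : ∀ j, ∑ D ∈ Fam j, ∏ i ∈ D, (α * Real.exp (-(t * d j i))) ≤ 1)
    (hsmall : F * Real.exp (5 * r) ≤ α) :
    ∑ Df ∈ Fintype.piFinset Fam, ∏ j, ∏ i ∈ Df j, (F * Real.exp (-(u * d j i))) ≤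
      ∏ j, (F / α * Real.exp (-(r * dC j))) := by
  rw [← Finset.prod_univ_sum Fam (fun j D => ∏ i ∈ D, (F * Real.exp (-(u * d j i))))]
  exact Finset.prod_le_prod (fun j _ => Finset.sum_nonneg fun D _ => Finset.prod_nonneg fun i _ => by positivity)
    (fun j _ => familyStep (Fam j) (d j) hF hα hr hu (h227 j) (h229 j) hsmall)

/-! ## §3  Bookkeeping against `B13.Consts`: the printed restrictions vs. the consumed one -/

section Consts

/-- The per-member constant of p. 20 l. 3, *"ε₂ replaced by (L+2)⁴O(1)ε₂"*, with `A` := that O(1) and ε₂ the p. 19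
product `B13.Consts.eps2`. [cite: Balaban1988RG2Cluster, p.20 (before (2.37))] -/
def memberF (c : B13.Consts) (A : ℝ) : ℝ := ((c.L : ℝ) + 2) ^ 4 * A * c.eps2

/-- The bracket constant of (2.37), *"The sum over n ≧ 1 is now bounded by 2(L+2)⁴O(1)ε₂"*. [cite: Balaban1988RG2Cluster, (2.37) p.20] -/
def bracketF (c : B13.Consts) (A : ℝ) : ℝ := 2 * memberF c A

/-- Printed restriction p. 20 l. 5, verbatim: *"assuming that (L+2)⁴O(1)ε₂ ≦ ½"* (cell transcript R18, folded into
the cell census row R18). [cite: Balaban1988RG2Cluster, p.20 (before (2.37))] -/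
def R18half (c : B13.Consts) (A : ℝ) : Prop := memberF c A ≤ 1 / 2

/-- Printed restriction p. 20 l. 8, verbatim: *"Assuming that 2(L+2)⁴O(1)ε₂ exp 5κ ≦ 1, we obtain for a fixed Z′₀,
(2.37)"* (cell census R18). [cite: Balaban1988RG2Cluster, p.20 (before (2.37))] -/
def R18 (c : B13.Consts) (A : ℝ) : Prop := bracketF c A * Real.exp (5 * c.κ) ≤ 1

/-- The restriction the family / merging step at scale k + 1 actually CONSUMES (`familyStep` with F = bracketF,
α = α₆, r = (1−7δ)ℓκ; C-adv7-162 (d)): `2(L+2)⁴·A·ε₂ · exp 5(1−7δ)ℓκ ≤ α₆`, ℓ the transfer factor (½L in print).  NOT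
printed. [cite: Balaban1988RG2Cluster, p.20 (before (2.37))] -/
def R18sharp (c : B13.Consts) (A ℓ : ℝ) : Prop :=
  bracketF c A * Real.exp (5 * ((1 - 7 * c.δ) * ℓ * c.κ)) ≤ c.α₆

/-- Under `R18half` the n-resummation delivers at most the bracket constant: Σ_{1≤n≤N} memberF^n ≤ bracketF. [cite: Balaban1988RG2Cluster, p.20 (before (2.37))] -/
theorem nsum_le_bracketF (c : B13.Consts) (A : ℝ) (h0 : 0 ≤ memberF c A) (h : R18half c A) (N : ℕ) :
    ∑ n ∈ Finset.range N, memberF c A ^ (n + 1) ≤ bracketF c A :=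
  nsum_le_two_mul h0 h N

/-- `bracketF c A = 2(L+2)⁴·A·ε₂` spelled out. [cite: Balaban1988RG2Cluster, (2.37) p.20] -/
theorem bracketF_eq (c : B13.Consts) (A : ℝ) : bracketF c A = 2 * ((c.L : ℝ) + 2) ^ 4 * A * c.eps2 := by
  unfold bracketF memberF
  ring

/-- With A = the field `A₁` (the O(1) printed inside C₃) the bracket constant is `C₃ε₁` (`B13.Consts.C3act_mul_eps1`:
*"We leave one factor 2(L+2)⁴O(1)ε₂"*, p. 20). [cite: Balaban1988RG2Cluster, p.20 (definition of C₃)] -/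
theorem bracketF_A1 (c : B13.Consts) : bracketF c c.A₁ = c.C3act * c.ε₁ := by
  rw [bracketF_eq, B13.Consts.C3act_mul_eps1]

/-- THE ABSORPTION READING (DIVERGENCE D-b13.33).  If the O(1) printed in C₃ is read as `A₁ = A/α₆` — A the O(1) of
p. 20 l. 3, the extra α₆⁻¹ being the factor lent to (2.29) by `familyStep` — then the surviving bracket `bracketF/α₆`
is literally `C₃ε₁`. [cite: Balaban1988RG2Cluster, p.20 (definition of C₃)] -/
theorem bracketF_rebased (c : B13.Consts) (A : ℝ) (hα : c.α₆ ≠ 0) (hA : c.A₁ = A / c.α₆) :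
    bracketF c A / c.α₆ = c.C3act * c.ε₁ := by
  rw [← bracketF_A1, bracketF_eq, bracketF_eq, hA]
  field_simp

/-- Under the absorption reading the consumed restriction `R18sharp` reads `C₃ε₁ · exp 5(1−7δ)ℓκ ≤ 1` — the printed
shape *"… ≦ 1"* with C₃ε₁ for 2(L+2)⁴O(1)ε₂ and the rate 5(1−7δ)ℓκ for 5κ. [cite: Balaban1988RG2Cluster, p.20 (before (2.37))] -/
theorem R18sharp_iff_rebased (c : B13.Consts) (A ℓ : ℝ) (hα : 0 < c.α₆) (hA : c.A₁ = A / c.α₆) :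
    R18sharp c A ℓ ↔ c.C3act * c.ε₁ * Real.exp (5 * ((1 - 7 * c.δ) * ℓ * c.κ)) ≤ 1 := by
  rw [← bracketF_rebased c A hα.ne' hA, div_mul_eq_mul_div, div_le_one hα]
  rfl

/-- The merged rate under the closing assumption `(1 − 10δ)ℓ = 1` (`B13.Consts.R22gen`; `rates_of_R22gen`):
`5(1−7δ)ℓκ = 5κ + 15δℓκ`.  So the printed `exp 5κ` understates the merging cost by the factor `exp 15δℓκ` (and the
cell's earlier sharp form with (1−6δ), GAPS G-B13-10, over-books it by `exp 5δℓκ`). [cite: Balaban1988RG2Cluster, p.20 (before (2.37)) and p.21 (after (2.41))] -/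
theorem five_rate_of_R22gen (c : B13.Consts) {ℓ : ℝ} (h : c.R22gen ℓ) :
    5 * ((1 - 7 * c.δ) * ℓ * c.κ) = 5 * c.κ + 15 * c.δ * ℓ * c.κ := by
  have h7 := (B13.Consts.rates_of_R22gen c h).2.1
  calc 5 * ((1 - 7 * c.δ) * ℓ * c.κ) = 5 * ((1 - 7 * c.δ) * ℓ) * c.κ := by ring
    _ = 5 * (1 + 3 * c.δ * ℓ) * c.κ := by rw [h7]
    _ = 5 * c.κ + 15 * c.δ * ℓ * c.κ := by ring

/-- The consumed restriction implies the printed one (for a non-negative bracket constant, `α₆ ≤ 1`, `δ, ℓ, κ ≥ 0` and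
the closing assumption): the printed *"2(L+2)⁴O(1)ε₂ exp 5κ ≦ 1"* is NECESSARY for what the step uses, not sufficient
as displayed. [cite: Balaban1988RG2Cluster, p.20 (before (2.37))] -/
theorem R18_of_R18sharp (c : B13.Consts) (A : ℝ) {ℓ : ℝ} (hF : 0 ≤ bracketF c A) (hα1 : c.α₆ ≤ 1) (hδ : 0 ≤ c.δ)
    (hℓ : 0 ≤ ℓ) (hκ : 0 ≤ c.κ) (h22 : c.R22gen ℓ) (h : R18sharp c A ℓ) : R18 c A := by
  unfold R18
  unfold R18sharp at h
  rw [five_rate_of_R22gen c h22] at h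
  have hexp : Real.exp (5 * c.κ) ≤ Real.exp (5 * c.κ + 15 * c.δ * ℓ * c.κ) := by
    apply Real.exp_le_exp.mpr
    have : 0 ≤ 15 * c.δ * ℓ * c.κ := by positivity
    linarith
  calc bracketF c A * Real.exp (5 * c.κ) ≤ bracketF c A * Real.exp (5 * c.κ + 15 * c.δ * ℓ * c.κ) :=
        mul_le_mul_of_nonneg_left hexp hF
    _ ≤ c.α₆ := h
    _ ≤ 1 := hα1

/-- §2 INSTANTIATED ON THE CONSTANTS RECORD.  Per connected component C of Z′₀ at scale k + 1 (transfer factor ℓ, ½L in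
print): from (2.27), (2.29) at weight `α₆·exp(−δℓκ·d)` and the consumed restriction `R18sharp c A ℓ`, the sum over the
families of the member weights `2(L+2)⁴Aε₂·exp(−(1−6δ)ℓκ·d_{k+1}(Z′))` is at most
`(2(L+2)⁴Aε₂/α₆)·exp(−(1−7δ)ℓκ·d_{k+1}(C))`. [cite: Balaban1988RG2Cluster, (2.37) p.20] -/
theorem familyStep_consts (c : B13.Consts) (A ℓ : ℝ) {ι : Type*} (Fam : Finset (Finset ι)) (d : ι → ℝ) (dC : ℝ)
    (hF : 0 ≤ bracketF c A) (hα : 0 < c.α₆) (hr : 0 ≤ (1 - 7 * c.δ) * ℓ * c.κ)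
    (h227 : ∀ D ∈ Fam, D.Nonempty ∧ dC + 5 ≤ ∑ i ∈ D, (d i + 5))
    (h229 : ∑ D ∈ Fam, ∏ i ∈ D, (c.α₆ * Real.exp (-(c.δ * ℓ * c.κ * d i))) ≤ 1)
    (h18 : R18sharp c A ℓ) :
    ∑ D ∈ Fam, ∏ i ∈ D, (bracketF c A * Real.exp (-((1 - 6 * c.δ) * ℓ * c.κ * d i))) ≤
      bracketF c A / c.α₆ * Real.exp (-((1 - 7 * c.δ) * ℓ * c.κ * dC)) :=
  familyStep Fam d hF hα hr (by ring) h227 h229 h18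

/-- The same under the absorption reading `A₁ = A/α₆`: the surviving bracket is `C₃ε₁·exp(−(1−7δ)ℓκ·d_{k+1}(C))` — the
bracket of (2.37) with print's own C₃ of p. 20 (before the last δ is spent on p. 20 ll. 11–22 to reach the rate (1−8δ)
of (2.38)). [cite: Balaban1988RG2Cluster, (2.37)–(2.38) p.20] -/
theorem familyStep_consts_rebased (c : B13.Consts) (A ℓ : ℝ) {ι : Type*} (Fam : Finset (Finset ι)) (d : ι → ℝ)
    (dC : ℝ) (hF : 0 ≤ bracketF c A) (hα : 0 < c.α₆) (hA : c.A₁ = A / c.α₆)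
    (hr : 0 ≤ (1 - 7 * c.δ) * ℓ * c.κ)
    (h227 : ∀ D ∈ Fam, D.Nonempty ∧ dC + 5 ≤ ∑ i ∈ D, (d i + 5))
    (h229 : ∑ D ∈ Fam, ∏ i ∈ D, (c.α₆ * Real.exp (-(c.δ * ℓ * c.κ * d i))) ≤ 1)
    (h18 : R18sharp c A ℓ) :
    ∑ D ∈ Fam, ∏ i ∈ D, (bracketF c A * Real.exp (-((1 - 6 * c.δ) * ℓ * c.κ * d i))) ≤
      c.C3act * c.ε₁ * Real.exp (-((1 - 7 * c.δ) * ℓ * c.κ * dC)) := by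
  rw [← bracketF_rebased c A hα.ne' hA]
  exact familyStep_consts c A ℓ Fam d dC hF hα hr h227 h229 h18

end Consts

end Literature.MathematicalPhysics.QuantumFieldTheory.Balaban1983to89.B13Step237
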